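import Mathlib
import HarnessLib

/-!
# Crux `UnitSpeedTwoPoint` — stub B2 `stub_gaussianCosFourierPlane` (line `yukawa_subordination`)

Crux stmt-CriticalPhenomena-17167 (`Theses.UnitLightCone.UnitSpeedTwoPoint`), line
`yukawa_subordination`, registered helper stub B2 feeding stub B (`stub_sommerfeldWeyl`,
the Sommerfeld–Weyl identity by Gaussian subordination): **the Gaussian cosine transform
on the plane**.  For `u > 0` and `a b : ℝ`,

* the Gaussian weight `k ↦ e^{-u‖k‖²}` is integrable on `ℝ² = EuclideanSpace ℝ (Fin 2)`, and
* `∫_{ℝ²} cos (k₀ a + k₁ b) e^{-u‖k‖²} d²k = (π / u) e^{-(a² + b²)/(4u)}`.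

Proof.  Both conjuncts are the real parts of Mathlib's complex Gaussian formulas
`GaussianFourier.integrable_cexp_neg_mul_sq_norm_add_of_euclideanSpace` and
`GaussianFourier.integral_cexp_neg_mul_sq_norm_add_of_euclideanSpace`
(`∫ e^{-b‖v‖² + c⟪w,v⟫} dv = (π/b)^{card ι / 2} e^{c²‖w‖²/(4b)}` for `0 < re b`) at
`ι = Fin 2`, `b = u`, `c = i`, `w = (a, b)`: then `⟪w, k⟫ = k₀ a + k₁ b`, `‖w‖² = a² + b²`,
`c² = -1`, `(π/u)^{2/2} = π/u`, and `Re e^{-u‖k‖² + i⟪w,k⟫} = cos (k₀ a + k₁ b) e^{-u‖k‖²}`;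
the real part commutes with the Bochner integral (`integral_re`).  All steps are standard
analysis [folklore].
-/

noncomputable section

open MeasureTheory Complex
open scoped RealInnerProductSpace

namespace Summit.CriticalPhenomena.Ising3DConformalLimit.Cruxes.UnitSpeedTwoPoint.YukawaSubordination

/-- The frequency vector `w = (a, b) ∈ ℝ²` pairs with `k` as `⟪w, k⟫ = k₀ a + k₁ b`.
[folklore] -/
theorem gaussianCosFourierPlane_inner (a b : ℝ) (k : EuclideanSpace ℝ (Fin 2)) :
    ⟪(WithLp.toLp 2 ![a, b] : EuclideanSpace ℝ (Fin 2)), k⟫ = k 0 * a + k 1 * b := by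
  simp [PiLp.inner_apply, Fin.sum_univ_two]

/-- `‖(a, b)‖² = a² + b²` in `ℝ²`. [folklore] -/
theorem gaussianCosFourierPlane_norm_sq (a b : ℝ) :
    ‖(WithLp.toLp 2 ![a, b] : EuclideanSpace ℝ (Fin 2))‖ ^ 2 = a ^ 2 + b ^ 2 := by
  simp [EuclideanSpace.real_norm_sq_eq, Fin.sum_univ_two]

/-- Integrability of the Gaussian weight `k ↦ e^{-u‖k‖²}` on `ℝ²` for `u > 0` (the norm of
Mathlib's integrable complex Gaussian `e^{-u‖k‖² + 0·⟪0,k⟫}`). [folklore] -/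
theorem gaussianCosFourierPlane_integrable {u : ℝ} (hu : 0 < u) :
    Integrable (fun k : EuclideanSpace ℝ (Fin 2) => Real.exp (-(u * ‖k‖ ^ 2))) := by
  have hb : 0 < (u : ℂ).re := by rwa [Complex.ofReal_re]
  have h := (GaussianFourier.integrable_cexp_neg_mul_sq_norm_add_of_euclideanSpace hb 0
    (0 : EuclideanSpace ℝ (Fin 2))).norm
  refine h.congr (ae_of_all _ fun k => ?_)
  have h1 :
      (-(u : ℂ) * (‖k‖ : ℂ) ^ 2 + 0 * (⟪(0 : EuclideanSpace ℝ (Fin 2)), k⟫ : ℂ)) =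
        ((-(u * ‖k‖ ^ 2) : ℝ) : ℂ) := by
    push_cast
    ring
  simp only [h1, Complex.norm_exp, Complex.ofReal_re]

/-- Real part of the oscillatory Gaussian on `ℝ²`: for `w = (a, b)`,
`Re e^{-u‖k‖² + i⟪w,k⟫} = cos (k₀ a + k₁ b) e^{-u‖k‖²}`. [folklore] -/
theorem gaussianCosFourierPlane_re (u a b : ℝ) (k : EuclideanSpace ℝ (Fin 2)) :
    (cexp (-(u : ℂ) * ‖k‖ ^ 2 +
        I * ⟪(WithLp.toLp 2 ![a, b] : EuclideanSpace ℝ (Fin 2)), k⟫)).re =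
      Real.cos (k 0 * a + k 1 * b) * Real.exp (-(u * ‖k‖ ^ 2)) := by
  rw [gaussianCosFourierPlane_inner]
  have hz : -(u : ℂ) * (‖k‖ : ℂ) ^ 2 + I * ((k 0 * a + k 1 * b : ℝ) : ℂ) =
      ((-(u * ‖k‖ ^ 2) : ℝ) : ℂ) + ((k 0 * a + k 1 * b : ℝ) : ℂ) * I := by
    push_cast
    ring
  rw [hz, Complex.exp_re]
  simp only [Complex.add_re, Complex.add_im, Complex.ofReal_re, Complex.ofReal_im,
    Complex.mul_I_re, Complex.mul_I_im, neg_zero, add_zero, zero_add]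
  rw [mul_comm]

/-- **Stub B2** (Gaussian cosine transform on the plane).  For `u > 0` the Gaussian weight
`e^{-u‖k‖²}` is integrable on `ℝ²` and
`∫_{ℝ²} cos (k₀ a + k₁ b) e^{-u‖k‖²} d²k = (π / u) e^{-(a² + b²)/(4u)}`.
[folklore] -/
theorem stub_gaussianCosFourierPlane :
    ∀ u a b : ℝ, 0 < u →
      MeasureTheory.Integrable (fun k : EuclideanSpace ℝ (Fin 2) => Real.exp (-(u * ‖k‖ ^ 2))) ∧
        ∫ k : EuclideanSpace ℝ (Fin 2), Real.cos (k 0 * a + k 1 * b) * Real.exp (-(u * ‖k‖ ^ 2)) =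
          Real.pi / u * Real.exp (-((a ^ 2 + b ^ 2) / (4 * u))) := by
  intro u a b hu
  refine ⟨gaussianCosFourierPlane_integrable hu, ?_⟩
  have hb : 0 < (u : ℂ).re := by rwa [Complex.ofReal_re]
  have hInt := GaussianFourier.integrable_cexp_neg_mul_sq_norm_add_of_euclideanSpace hb I
    (WithLp.toLp 2 ![a, b] : EuclideanSpace ℝ (Fin 2))
  have hI := GaussianFourier.integral_cexp_neg_mul_sq_norm_add_of_euclideanSpace hb I
    (WithLp.toLp 2 ![a, b] : EuclideanSpace ℝ (Fin 2))
  have hre : ∫ k : EuclideanSpace ℝ (Fin 2),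
        Real.cos (k 0 * a + k 1 * b) * Real.exp (-(u * ‖k‖ ^ 2)) =
      RCLike.re (∫ k : EuclideanSpace ℝ (Fin 2), cexp (-(u : ℂ) * ‖k‖ ^ 2 +
        I * ⟪(WithLp.toLp 2 ![a, b] : EuclideanSpace ℝ (Fin 2)), k⟫)) := by
    rw [← integral_re hInt]
    refine integral_congr_ae (ae_of_all _ fun k => ?_)
    simp only [RCLike.re_to_complex, gaussianCosFourierPlane_re]
  rw [hre, hI, Fintype.card_fin, Complex.I_sq, RCLike.re_to_complex]
  have h1 : ((2 : ℕ) : ℂ) / 2 = 1 := by norm_num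
  have h2 : (Real.pi : ℂ) / (u : ℂ) = ((Real.pi / u : ℝ) : ℂ) :=
    (Complex.ofReal_div _ _).symm
  have h3 :
      -1 * (‖(WithLp.toLp 2 ![a, b] : EuclideanSpace ℝ (Fin 2))‖ : ℂ) ^ 2 / (4 * (u : ℂ)) =
        ((-((a ^ 2 + b ^ 2) / (4 * u)) : ℝ) : ℂ) := by
    rw [← Complex.ofReal_pow, gaussianCosFourierPlane_norm_sq]
    push_cast
    ring
  rw [h1, Complex.cpow_one, h2, h3, ← Complex.ofReal_exp, ← Complex.ofReal_mul,
    Complex.ofReal_re]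

end Summit.CriticalPhenomena.Ising3DConformalLimit.Cruxes.UnitSpeedTwoPoint.YukawaSubordination

end
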